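import Summits.CriticalPhenomena.PercolationContinuityZ3.Theorems.PercNearOneGluingNoHeavyLowerTailCovTauOfTA
import Literature.Probability.Percolation.TwoSetConditionalAssociation
import Literature.Probability.Percolation.KozmaNitzanSeparatingTriple
import HarnessLib

/-!
# The observer constant of the covariance transfer MDL(X) with a NONEMPTY avoided set is not sharp:
# the jointly-conditioned constant `p' = P(v ↔ o | v ↮ {x}∪Y, x ↮ Y) ≥ p`, and the conjecture MDL(X)′

builds on p205010 (kernel theorem, internal audit signed; external expert review pending)

PAPER-2 track "percolation constants", part (ii) (explicit constants across the CSH inequality family), seat `prim-consts-2`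
(sharpening).  Support file (`--supports stmt-CriticalPhenomena-4575`): one `Prop` definition (an OPEN strengthening, tagged
`@[conjecture]`), two theorems; no sorries; standard axioms.

Level `0` of the conditioned slack hierarchy CSH (`CSH.cshMargin_nil_nonneg`) is the covariance transfer with an avoided set,
MDL(X) = `CovTau.markerDominanceAvoid`: for the owner `s`, an avoided set `X`, markers `y ≠ s` ("`v`") and `z` ("`o`"), and every
monotone functional `F` of the open edge cluster of `s`,

  `μ(𝒜 ∩ W) · cov_D(F; s ↔ y) ≤ μ(𝒜) · cov_D(F; s ↔ z)`,   `𝒜 = {y ↮ {s} ∪ X}`, `W = {y ↔ z}`, `D = {s ↮ X}`,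

`cov_D(F; E) = μ(D) ∫_{D∩E} F(C_s) − (∫_D F(C_s)) μ(D ∩ E)`; i.e. the transfer constant is `p = μ(W | 𝒜) = P(y ↔ z | y ↮ {s}∪X)`,
an UNCONDITIONAL-measure quantity although both covariances are taken under `μ( · | D)`.  For `X = ∅` the constant `p` is sharp
(equality at `F = 1{all pairs {u,y}, u ∈ {s}, open}`, paper 1 §3 / prim-paper-s3 F2).  For `X ≠ ∅` it is NOT (prim-paper-s3 F3:
`K₄`, weights `½`: `p = 1/5`, best constant `9/25`).  This file records where part of that slack is:

* `Consts.jointObserverConst_ge` — **THEOREM: `p ≤ p'`** where `p' := μ(W | 𝒜 ∩ D) = P(y ↔ z | y ↮ {s}∪X, s ↮ X)` is the constant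
  conditioned ALSO on the event `D` under which the covariances are taken; denominator-free: `μ(𝒜 ∩ W)·μ(𝒜 ∩ D) ≤ μ(𝒜)·μ(𝒜 ∩ D ∩ W)`.
  Proof: van den Berg–Häggström–Kahn's Theorem 1.4 with vertex SETS (`BHK2006_twoSetConditionalAssociation.negCorrelation`, a tree
  theorem): given `{y} ↮ {s} ∪ X`, the cluster of `y` (which carries `W`) and the cluster of `{s} ∪ X` (which carries `Dᶜ = {s ↔ X}`)
  are negatively correlated.  Equality iff `W` and `D` are uncorrelated given `𝒜`; generically `p' > p` (`K₄`, weights `½`: `p' = 1/4`).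
* `Consts.MDLXJoint` — **CONJECTURE MDL(X)′** (OPEN, this programme): MDL(X) holds with `p'` in place of `p`, i.e.
  `μ(𝒜 ∩ D ∩ W) · cov_D(F; s ↔ y) ≤ μ(𝒜 ∩ D) · cov_D(F; s ↔ z)` for every monotone `F`.  By `jointObserverConst_ge` (and
  `cov_D(F; s ↔ y) ≥ 0`, vdBHK Thm 1.3) it implies MDL(X).  EVIDENCE (exact rational arithmetic, this seat, folder
  `work/explore/` of prover-prim-consts-2; the sharp constant `p_hi(G,w) = min over up-sets U of the edge-cluster poset of
  cov_D(1_U; z)/cov_D(1_U; y)` computed by Dinkelbach iteration over min-cuts): `p' ≤ p_hi` on ALL of 850 random weighted graphs with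
  `4 ≤ n ≤ 6`, `|X| ∈ {1,2}`, weights in `{k/20} ∪ {k/4} ∪ {k/3} ∪ {0}`, and along 4 adversarial hill-climbs minimising `p_hi/p'`
  (≈ 3·10⁴ evaluations, `n = 5, 6`): minimum ratio `p_hi/p' = 1`, attained only where `p_hi = p' = p`; among the 3·C(7,≤3) conditional
  probabilities `P(E₀ | E₁,…,E_k)` built from `{y↔z, y↔z off s, y↔z off s,X} × {y↮s, y↮X, s↮X, z↮X, z↮s, s↔X, y↔s}` it is the unique
  maximal one that is admissible on all 80 test graphs.  CAVEAT (also exact): the WITHIN-WORLD route by which the tree proves MDL(X)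
  (`HullPort.markerDominanceAvoid_of_TA`: Gibbs-sampler reduction to the worlds `G ∖ C_X(ω)` + the `X = ∅` lemma world by world + the
  averaged inequality `T_A ≥ 0`) does NOT prove MDL(X)′ — the analogous functional `T_A′ = Σ_K μ(C_X = K)(r_K − p')c_K` is negative at
  `K₄`, weights `(¾,½,¾,¾,¾,¾)`: within-world optimum `9/25 < p' = 3/8` while the full optimum is `105/187`; the between-world
  covariance is needed.  A census request for `n = 7` (all graphs, exhaustive small palettes) is filed with ttrl2 (consts).
* `Consts.mdlxJoint_of_isEmpty` — the `X = ∅` instance of MDL(X)′ IS the tree's MDL(∅) (`D = univ`), hence true.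

References: J. van den Berg, O. Häggström, J. Kahn, *Some conditional correlation inequalities for percolation and related
processes*, Random Struct. Alg. 29 (2006), Thms. 1.3–1.5, Thm. 2.1, Remark 1 after Thm. 1.2; G. Kozma, N. Nitzan, arXiv:2401.12397.
-/

noncomputable section

namespace Summit.CriticalPhenomena.PercolationContinuityZ3.Theorems

open MeasureTheory Set Literature.Probability.LatticeModels Literature.Probability.Percolation
open scoped Classical

namespace Consts

variable {V : Type*} [Fintype V]

/-- **`p ≤ p'`: the jointly-conditioned observer constant dominates the tree's.**  For any weights, owner `s`, avoided set `X`,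
markers `y, z`: `μ(𝒜 ∩ W) · μ(𝒜 ∩ D) ≤ μ(𝒜) · μ(𝒜 ∩ D ∩ W)` with `𝒜 = {y ↮ {s}∪X}`, `W = {y ↔ z}`, `D = {s ↮ X}`, i.e.
`P(y ↔ z | y ↮ {s}∪X) ≤ P(y ↔ z | y ↮ {s}∪X, s ↮ X)`.  From van den Berg–Häggström–Kahn's Theorem 1.4 for the vertex sets
`{y}` and `{s} ∪ X`: `1{z ∈ C_y}` and `1{s ↔ X}` (read on `C_{{s}∪X}`) are negatively correlated given `y ↮ {s} ∪ X`.
[cite: VandenbergHaggstromKahn2005, Thm. 1.4 (p. 7) with Remark 1 after Thm. 1.2 (p. 5); Thm. 2.1 (p. 9) at q = 1] -/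
theorem jointObserverConst_ge (w : Sym2 V → unitInterval) (s y z : V) (X : Set V) :
    (prodBernoulli w).real ({ω : BondConfig V | ∀ x ∈ insert s X, ¬ (openGraph ω).Reachable y x} ∩ openConn y z) *
      (prodBernoulli w).real ({ω : BondConfig V | ∀ x ∈ insert s X, ¬ (openGraph ω).Reachable y x} ∩
        {ω | ∀ x ∈ X, ¬ (openGraph ω).Reachable s x}) ≤
    (prodBernoulli w).real {ω : BondConfig V | ∀ x ∈ insert s X, ¬ (openGraph ω).Reachable y x} *
      (prodBernoulli w).real ({ω : BondConfig V | ∀ x ∈ insert s X, ¬ (openGraph ω).Reachable y x} ∩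
        {ω | ∀ x ∈ X, ¬ (openGraph ω).Reachable s x} ∩ openConn y z) := by
  classical
  set μ := prodBernoulli w with hμ
  set 𝒜 : Set (BondConfig V) := {ω | ∀ x ∈ insert s X, ¬ (openGraph ω).Reachable y x} with h𝒜
  set W : Set (BondConfig V) := openConn y z with hW
  set D : Set (BondConfig V) := {ω | ∀ x ∈ X, ¬ (openGraph ω).Reachable s x} with hD
  set J : Set (BondConfig V) := {ω | ∃ x ∈ X, (openGraph ω).Reachable s x} with hJ
  -- the BHK conditioning event `{ {y} ↮ insert s X }` is `𝒜`
  have h𝒜' : {ω : BondConfig V | ∀ a ∈ ({y} : Set V), ∀ t ∈ insert s X, ¬ (openGraph ω).Reachable a t} = 𝒜 := by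
    ext ω
    simp only [h𝒜, mem_setOf_eq, mem_singleton_iff, forall_eq]
  -- the two increasing cluster functionals
  set F : Set (Sym2 V) → ℝ := connIndicatorFn y z with hF
  set G : Set (Sym2 V) → ℝ := fun C => if (∃ x ∈ X, (openGraph C).Reachable s x) then (1 : ℝ) else 0 with hG
  have hFm : Monotone F := monotone_connIndicatorFn y z
  have hGm : Monotone G := by
    refine TripodExchange.predIndicator_monotone ?_
    rintro C C' hCC' ⟨x, hx, hr⟩
    exact ⟨x, hx, hr.mono (openGraph_mono hCC')⟩
  -- reading them on a configuration
  have hFω : ∀ ω : BondConfig V, F (⋃ a ∈ ({y} : Set V), openEdgeCluster ω a) = W.indicator 1 ω := by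
    intro ω
    have : (⋃ a ∈ ({y} : Set V), openEdgeCluster ω a) = openEdgeCluster ω y := by
      ext e; simp
    rw [this, hF, connIndicatorFn_openEdgeCluster]
  have hGω : ∀ ω : BondConfig V, G (⋃ t ∈ insert s X, openEdgeCluster ω t) = J.indicator 1 ω := by
    intro ω
    have hiff : (∃ x ∈ X, (openGraph (⋃ t ∈ insert s X, openEdgeCluster ω t)).Reachable s x) ↔
        ∃ x ∈ X, (openGraph ω).Reachable s x := by
      constructor
      · rintro ⟨x, hx, hr⟩
        exact ⟨x, hx, (KNSep.reachable_iff_cluster ω (insert s X) (mem_insert s X) x).2 hr⟩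
      · rintro ⟨x, hx, hr⟩
        exact ⟨x, hx, (KNSep.reachable_iff_cluster ω (insert s X) (mem_insert s X) x).1 hr⟩
    simp only [hG, hiff]
    exact TwoSetConditionalAssociation.predIndicator_eq_indicator (fun ω' => ∃ x ∈ X, (openGraph ω').Reachable s x) ω
  -- BHK Thm 1.4 with sets
  have key := BHK2006_twoSetConditionalAssociation.negCorrelation w {y} (insert s X) F G hFm hGm
  simp only [h𝒜', hFω, hGω, TripodExchange.setIntegral_indicator_one_eq,
    TripodExchange.setIntegral_indicator_mul_indicator_eq] at key
  -- key : μ.real 𝒜 * μ.real (𝒜 ∩ (W ∩ J)) ≤ μ.real (𝒜 ∩ W) * μ.real (𝒜 ∩ J)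
  -- measure bookkeeping: `D` and `J` partition
  have hWD : μ.real (𝒜 ∩ W ∩ D) + μ.real (𝒜 ∩ (W ∩ J)) = μ.real (𝒜 ∩ W) := by
    have h := measureReal_inter_add_sdiff (μ := μ) (s := 𝒜 ∩ W) (MeasurableSet.of_discrete : MeasurableSet D)
    have hset : (𝒜 ∩ W) \ D = 𝒜 ∩ (W ∩ J) := by
      ext ω
      simp only [hD, hJ, mem_sdiff, mem_inter_iff, mem_setOf_eq, not_forall, not_not, exists_prop]
      tauto
    rwa [hset] at h
  have h𝒜D : μ.real (𝒜 ∩ D) + μ.real (𝒜 ∩ J) = μ.real 𝒜 := by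
    have h := measureReal_inter_add_sdiff (μ := μ) (s := 𝒜) (MeasurableSet.of_discrete : MeasurableSet D)
    have hset : 𝒜 \ D = 𝒜 ∩ J := by
      ext ω
      simp only [hD, hJ, mem_sdiff, mem_inter_iff, mem_setOf_eq, not_forall, not_not, exists_prop]
    rwa [hset] at h
  have hcomm : 𝒜 ∩ D ∩ W = 𝒜 ∩ W ∩ D := inter_right_comm 𝒜 D W
  rw [hcomm]
  have h1 : μ.real (𝒜 ∩ D) = μ.real 𝒜 - μ.real (𝒜 ∩ J) := by linarith
  have h2 : μ.real (𝒜 ∩ W ∩ D) = μ.real (𝒜 ∩ W) - μ.real (𝒜 ∩ (W ∩ J)) := by linarith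
  rw [h1, h2]
  nlinarith [key]

/-- **CONJECTURE MDL(X)′ — the covariance transfer with an avoided set holds with the JOINTLY-CONDITIONED observer constant.**
For every finite weighted graph (`Fin n`, weights `w`, `μ = prodBernoulli w`), owner `s`, avoided set `X`, markers `y ≠ s` and `z`,
and every monotone functional `F` of the open edge cluster of `s`:
`μ(𝒜 ∩ D ∩ W) · cov_D(F; s ↔ y) ≤ μ(𝒜 ∩ D) · cov_D(F; s ↔ z)`, where `𝒜 = {y ↮ {s}∪X}`, `W = {y ↔ z}`, `D = {s ↮ X}` and
`cov_D(F; E) = μ(D) ∫_{D∩E} F(C_s) dμ − (∫_D F(C_s) dμ) μ(D ∩ E)`; i.e. the transfer constant `P(y ↔ z | y ↮ {s}∪X)` of the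
tree's MDL(X) (`CovTau.markerDominanceAvoid`) is replaced by the larger (`Consts.jointObserverConst_ge`)
`P(y ↔ z | y ↮ {s}∪X, s ↮ X)`.  For `X = ∅` this IS MDL(∅) (`Consts.mdlxJoint_of_isEmpty`).  OPEN (conjectured in this programme,
PAPER-2 consts track, seat prim-consts-2, 2026-08-20): exact census `n ≤ 6` (850 random weighted graphs, 4 adversarial climbs,
0 violations; the sharp constant equals it only where it equals the tree's); NOT reachable by the tree's within-world reduction
(the averaged functional `T_A′` is negative on `K₄` with weights `(¾,½,¾,¾,¾,¾)`).
builds on p205010 (kernel theorem, internal audit signed; external expert review pending).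
[cite: VandenbergHaggstromKahn2005, §2.1 (pp. 9–13) (the world decomposition behind MDL(X))] [status: open] -/
@[conjecture] def MDLXJoint : Prop :=
  ∀ (n : ℕ) (w : Sym2 (Fin n) → unitInterval) (s y z : Fin n) (X : Set (Fin n)), s ≠ y →
    ∀ F : Set (Sym2 (Fin n)) → ℝ, Monotone F →
    (prodBernoulli w).real ({ω : BondConfig (Fin n) | ∀ x ∈ insert s X, ¬ (openGraph ω).Reachable y x} ∩
          {ω | ∀ x ∈ X, ¬ (openGraph ω).Reachable s x} ∩ openConn y z) *
        ((prodBernoulli w).real {ω : BondConfig (Fin n) | ∀ x ∈ X, ¬ (openGraph ω).Reachable s x} *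
            (∫ ω in {ω : BondConfig (Fin n) | ∀ x ∈ X, ¬ (openGraph ω).Reachable s x} ∩ openConn s y,
              F (openEdgeCluster ω s) ∂(prodBernoulli w)) -
          (∫ ω in {ω : BondConfig (Fin n) | ∀ x ∈ X, ¬ (openGraph ω).Reachable s x},
              F (openEdgeCluster ω s) ∂(prodBernoulli w)) *
            (prodBernoulli w).real ({ω : BondConfig (Fin n) | ∀ x ∈ X, ¬ (openGraph ω).Reachable s x} ∩ openConn s y)) ≤
      (prodBernoulli w).real ({ω : BondConfig (Fin n) | ∀ x ∈ insert s X, ¬ (openGraph ω).Reachable y x} ∩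
          {ω | ∀ x ∈ X, ¬ (openGraph ω).Reachable s x}) *
        ((prodBernoulli w).real {ω : BondConfig (Fin n) | ∀ x ∈ X, ¬ (openGraph ω).Reachable s x} *
            (∫ ω in {ω : BondConfig (Fin n) | ∀ x ∈ X, ¬ (openGraph ω).Reachable s x} ∩ openConn s z,
              F (openEdgeCluster ω s) ∂(prodBernoulli w)) -
          (∫ ω in {ω : BondConfig (Fin n) | ∀ x ∈ X, ¬ (openGraph ω).Reachable s x},
              F (openEdgeCluster ω s) ∂(prodBernoulli w)) *
            (prodBernoulli w).real ({ω : BondConfig (Fin n) | ∀ x ∈ X, ¬ (openGraph ω).Reachable s x} ∩ openConn s z))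

/-- **The `X = ∅` instance of MDL(X)′ holds**: with no avoided set `D = univ`, the two constants coincide and the statement is the
tree's MDL(∅) (`CovTau.markerDominanceAvoid` at `X = ∅`). [cite: VandenbergHaggstromKahn2005, Thm. 1.3 (p. 6)] -/
theorem mdlxJoint_of_isEmpty (n : ℕ) (w : Sym2 (Fin n) → unitInterval) (s y z : Fin n) (hsy : s ≠ y)
    (F : Set (Sym2 (Fin n)) → ℝ) (hF : Monotone F) :
    (prodBernoulli w).real ({ω : BondConfig (Fin n) | ∀ x ∈ insert s (∅ : Set (Fin n)), ¬ (openGraph ω).Reachable y x} ∩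
          {ω | ∀ x ∈ (∅ : Set (Fin n)), ¬ (openGraph ω).Reachable s x} ∩ openConn y z) *
        ((prodBernoulli w).real {ω : BondConfig (Fin n) | ∀ x ∈ (∅ : Set (Fin n)), ¬ (openGraph ω).Reachable s x} *
            (∫ ω in {ω : BondConfig (Fin n) | ∀ x ∈ (∅ : Set (Fin n)), ¬ (openGraph ω).Reachable s x} ∩ openConn s y,
              F (openEdgeCluster ω s) ∂(prodBernoulli w)) -
          (∫ ω in {ω : BondConfig (Fin n) | ∀ x ∈ (∅ : Set (Fin n)), ¬ (openGraph ω).Reachable s x},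
              F (openEdgeCluster ω s) ∂(prodBernoulli w)) *
            (prodBernoulli w).real ({ω : BondConfig (Fin n) | ∀ x ∈ (∅ : Set (Fin n)), ¬ (openGraph ω).Reachable s x} ∩
              openConn s y)) ≤
      (prodBernoulli w).real ({ω : BondConfig (Fin n) | ∀ x ∈ insert s (∅ : Set (Fin n)), ¬ (openGraph ω).Reachable y x} ∩
          {ω | ∀ x ∈ (∅ : Set (Fin n)), ¬ (openGraph ω).Reachable s x}) *
        ((prodBernoulli w).real {ω : BondConfig (Fin n) | ∀ x ∈ (∅ : Set (Fin n)), ¬ (openGraph ω).Reachable s x} *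
            (∫ ω in {ω : BondConfig (Fin n) | ∀ x ∈ (∅ : Set (Fin n)), ¬ (openGraph ω).Reachable s x} ∩ openConn s z,
              F (openEdgeCluster ω s) ∂(prodBernoulli w)) -
          (∫ ω in {ω : BondConfig (Fin n) | ∀ x ∈ (∅ : Set (Fin n)), ¬ (openGraph ω).Reachable s x},
              F (openEdgeCluster ω s) ∂(prodBernoulli w)) *
            (prodBernoulli w).real ({ω : BondConfig (Fin n) | ∀ x ∈ (∅ : Set (Fin n)), ¬ (openGraph ω).Reachable s x} ∩
              openConn s z)) := by
  have key := CovTau.markerDominanceAvoid w s y z (∅ : Set (Fin n)) hsy F hF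
  have hD : {ω : BondConfig (Fin n) | ∀ x ∈ (∅ : Set (Fin n)), ¬ (openGraph ω).Reachable s x} = Set.univ := by
    ext ω; simp
  simp only [hD, Set.inter_univ] at key ⊢
  exact key

end Consts

end Summit.CriticalPhenomena.PercolationContinuityZ3.Theorems

end
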